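import Literature.AlgebraicGeometry.AbelianSchemes.AbelianSchemeOverSerreLemma
import HarnessLib

/-!
# Level structures transport along an isomorphism of abelian schemes over the same base

Topic `Literature/AlgebraicGeometry/AbelianSchemes`; theorems only (no definition, no named fact, no
instance). [MumfordFogartyKirwan1994] Ch. 7 §2 Def. 7.2 reads triples «up to isomorphism»: a
level-`n` structure (Def. 7.1: `2g` sections that are `n`-torsion and a basis of `X_s[n]` at every
geometric point) moves along an isomorphism `e : X₂ ≅ X₁` of `S`-group schemes (Mathlib `IsMonHom`)
by composing the sections with `e`. The relation currency is served by the tree: ★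
`isBaseChangeVia_id_of_isMonHom` / `levelStructure_isBaseChangeVia_id_of_isMonHom`
(`AbelianSchemeOverFibreIdentity`) turn `(e, φ₂.σ i ≫ e = φ₁.σ i)` into `φ₂.IsBaseChangeVia φ₁ (𝟙 S)`,
and ★ `exists_iso_of_isBaseChangeVia_id` (`ModuliOfAbelianVarieties/SiegelAdmissibleOfIsoId`) goes back;
Mumford's `σ^a` commutes with homomorphisms by ★ `sectionPow_comp_of_isMonHom`
(`AbelianSchemeOverSerreLemma`).

* `LevelStructure.exists_comp_of_iso` — a level-`n` structure `φ₂` on `A₂` yields one on `A₁`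
  with sections `φ₂.σ i ≫ e.hom` (the consumer: lifting level structures through an
  isomorphism of triples over `Spec ℂ`, `ModuliOfAbelianVarieties/SiegelModuliTowerLiftNilpotent`).

## References
* [MumfordFogartyKirwan1994] D. Mumford, J. Fogarty, F. Kirwan, *Geometric Invariant Theory*,
  3rd ed., Ch. 7 §2 Definitions 7.1 and 7.2 (p. 129).
* [GortzWedhorn2020] U. Görtz, T. Wedhorn, *Algebraic Geometry I*, 2nd ed., Prop. 4.16 (p. 101)
  (uniqueness of fibre products up to unique isomorphism).
-/

noncomputable section

open CategoryTheory CategoryTheory.Limits AlgebraicGeometry MonoidalCategory MonObj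

universe u

namespace Literature.AlgebraicGeometry.AbelianSchemes

namespace AbelianSchemeOver

variable {S : Scheme.{u}} {A₁ A₂ : AbelianSchemeOver S}

/-! ## Transport of level structures along an isomorphism of `S`-group schemes -/

/-- **A level structure moves along an isomorphism of `S`-group schemes**: if `e : X₂ ≅ X₁` over
`S` is a homomorphism and `φ₂` is a level-`n` structure on `A₂`, then the sections `φ₂.σ i ≫ e`
form a level-`n` structure on `A₁` — they are `n`-torsion (`(σ ≫ e)^n = σ^n ≫ e = 1`), and at
every geometric point `s` the `n^{2g}` points `(σ ≫ e)^a(s) = (σ^a)(s) ≫ e` are distinct and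
exhaust the `n`-torsion of `X₁,s` because post-composition by `e` is a bijection of `s`-points
compatible with the group laws (Mathlib `MonObj.mul_comp`/`pow_comp`, `IsMonHom e.inv`).
[cite: MumfordFogartyKirwan1994, Ch. 7 §2 Definitions 7.1 and 7.2
(p. 129)] -/
theorem LevelStructure.exists_comp_of_iso {g n : ℕ} (e : A₂.X ≅ A₁.X) [IsMonHom e.hom]
    (φ₂ : LevelStructure g n A₂) :
    ∃ φ₁ : LevelStructure g n A₁, ∀ i, φ₁.σ i = φ₂.σ i ≫ e.hom := by
  refine ⟨{ σ := fun i => φ₂.σ i ≫ e.hom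
            pow_σ := fun i => by rw [← MonObj.pow_comp, φ₂.pow_σ, MonObj.one_comp]
            basis_injective := ?_
            basis_surjective := ?_ }, fun i => rfl⟩
  · intro Ω _ _ s a b hab
    apply φ₂.basis_injective s
    -- `(σ ≫ e)^a (s) = σ^a(s) ≫ e`
    have key : ∀ c : Fin g ⊕ Fin g → ZMod n,
        A₁.restrict s (A₁.sectionPow (fun i => φ₂.σ i ≫ e.hom) c) =
          A₂.restrict s (A₂.sectionPow φ₂.σ c) ≫ e.hom := fun c => by
      rw [← A₂.sectionPow_comp_of_isMonHom e.hom φ₂.σ c]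
      rfl
    have h := hab
    simp only [key] at h
    exact (cancel_mono e.hom).mp h
  · intro Ω _ _ s x hx
    -- move `x` back to `A₂` along `e⁻¹`, which is again a homomorphism
    have hx₂ : (x ≫ e.inv) ^ n = 1 := by
      rw [← MonObj.pow_comp, hx, MonObj.one_comp]
    obtain ⟨a, ha⟩ := φ₂.basis_surjective s (x ≫ e.inv) hx₂
    refine ⟨a, ?_⟩
    rw [← A₂.sectionPow_comp_of_isMonHom e.hom φ₂.σ a]
    change (A₂.restrict s (A₂.sectionPow φ₂.σ a)) ≫ e.hom = x
    rw [ha, Category.assoc, e.inv_hom_id, Category.comp_id]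

end AbelianSchemeOver

end Literature.AlgebraicGeometry.AbelianSchemes
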